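import Mathlib.LinearAlgebra.Matrix.Permanent
import Mathlib.Data.Fintype.Perm
import Mathlib.Data.Nat.Sqrt
import Mathlib.Data.ZMod.Basic
import Literature.Computability.Complexity.BitGraphPPoly
import Literature.Computability.Complexity.CountingProofs
import Literature.Computability.AlgebraicComplexity.BurgisserBooleanPartsModPCircuits
import Literature.Computability.AlgebraicComplexity.ConstantFreeCircuits
import Literature.Computability.AlgebraicComplexity.TauConjectureProofs
import HarnessLib

/-!
# `τ(PER_n) = n^{O(1)}` puts the bits of the `0/1` permanent in `P/poly`; Bürgisser's Lemma 2.12 from Valiant's theorem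

Bürgisser, *On defining integers …* (ECCC TR06-113, Lemma 2.12 = Comput. Complexity 18 (2009);
STACS 2007, LNCS 4393, Lemma 11): "`τ(PER_n) = n^{O(1)}` implies `PP ⊆ P/poly`" — the tree's named
fact `PP_subset_PPoly_of_isPBounded_perPoly` (`TauConjectureProofs.lean`), one of the four facts
behind Bürgisser's transfer theorem `not_isPBounded_constantFreeComplexity_perPoly_of_tauConjecture`
(`TauConjectureAssembly.lean`) and one of the three behind the Koiran–Tavenas transfer
(`RealTauConjectureFinal.lean`). We PROVE it from the single classical theorem it quotes,
**Valiant 1979: the permanent of `0/1` matrices is `#P`-hard** (named fact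
`Valiant1979_per01Plain_isSharpPHardFun` below), along the printed route:

1. (`cktSize_permCount`) a constant-free, division-free fan-in-two circuit for `PER_n` over `ℤ`
   (size `τ(PER_n)`, `exists_computes_size_eq_constantFreeComplexity`) evaluated modulo
   `2^{n²+1} > n!` by Boolean circuits (`cktSize_testBits_aeval_eval`,
   `BurgisserBooleanPartsModPCircuits.lean`: school arithmetic mod `p`) computes ALL bits of the
   permanent of a `0/1` matrix (which lies in `[0, n!]`, `permCount_le_factorial`), in size
   `(τ(PER_n) + 1) · O(n⁶)`;
2. (`bitCircuits_per01Plain`) hence, if `τ(PER_n)` is polynomially bounded, the row-major `0/1`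
   permanent function `per01PlainFn` on bit strings has polynomial-size bit circuits, so its bit
   graph is in `P/poly` and `P^{per01PlainFn} ⊆ P/poly` (`BitGraphPPoly.lean`,
   `PPolyTuringClosure.lean`: `P/poly` is closed under polynomial-time Turing reductions);
3. (`PP_subset_PPoly_of_isPBounded_perPoly_of_valiant`) `PP ⊆ P^{#P}` (`PP_subset_PSharpP_holds`)
   `⊆ P^{per01PlainFn}` (Valiant's theorem: `#P ⊆ FP^{per01PlainFn}`, and `f ∈ FP^O ⟹ P^f ⊆ P^O`,
   `OracleAlg.PRel_subset_PRel_of_mem_FPRel`; the same three lines as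
   `QuantumComplexity.PSharpP_subset_PRel_ofFun_of_isSharpPHardFun`, inlined) `⊆ P/poly`.

## On the named fact

The tree already records Valiant's theorem as
`Literature.Computability.QuantumComplexity.permanent01_isSharpPHardFun` for the function
`per01Fn` reading square INTEGER matrices in the structured code `encodingIntMatrix` (the input
format of Aaronson–Arkhipov). Circuits cannot parse that variable-length code, and the tree has no
polynomial-time transcoder between the two formats, so we vendor the same printed theorem
(Valiant 1979, Thm. 1: "computing the permanent of a (0,1)-matrix is #P-complete", completeness
under polynomial-time Turing reductions) for the plainest input convention: an `n × n` `0/1`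
matrix IS the word of its `n²` entries in row-major order (`per01PlainFn`; words of non-square
length code nothing and are sent to `0`). Both are faithful transcriptions of the printed statement,
which fixes no bit-level encoding; they are interderivable by polynomial-time transcoding.

## References

* P. Bürgisser, ECCC TR06-113 (2006), Lemma 2.12; STACS 2007, LNCS 4393, pp. 133–144, Lemma 11;
  Comput. Complexity 18 (2009) 81–103.
* L. G. Valiant, *The complexity of computing the permanent*, TCS 8 (1979) 189–201, Thm. 1.
* S. Arora, B. Barak, *Computational Complexity* (2009), §17.2.1 (`PP ⊆ P^{#P}`), Thm. 17.11.
-/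

noncomputable section

namespace Literature.Computability.AlgebraicComplexity

open MvPolynomial Complexity ArithCircuit _root_.Computability

/-! ### The `0/1` permanent as a count of permutations -/

/-- The number of permutations `σ` of `Fin n` supported by the `0/1` array `y`:
`#{σ | ∀ i, y (σ i, i) = 1}` — the permanent of the `0/1` matrix `y`. [cite: Valiant1979, §1] -/
def permCount (n : ℕ) (y : Fin n × Fin n → Bool) : ℕ :=
  (Finset.univ.filter fun σ : Equiv.Perm (Fin n) => ∀ i, y (σ i, i) = true).card

/-- **The permanent of a `0/1` matrix counts permutations**, in any commutative semiring. [cite: Valiant1979, §1] -/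
theorem permanent_of_bool (R : Type*) [CommSemiring R] (n : ℕ) (y : Fin n × Fin n → Bool) :
    (Matrix.of fun i j : Fin n => if y (i, j) then (1 : R) else 0).permanent = permCount n y := by
  unfold Matrix.permanent permCount
  rw [Finset.card_eq_sum_ones, Nat.cast_sum, Finset.sum_filter]
  refine Finset.sum_congr rfl fun σ _ => ?_
  simp only [Matrix.of_apply, Nat.cast_one]
  split_ifs with h
  · exact Finset.prod_eq_one fun i _ => by rw [if_pos (h i)]
  · obtain ⟨i, hi⟩ := not_forall.1 h
    exact Finset.prod_eq_zero (Finset.mem_univ i) (by rw [if_neg hi])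

/-- `permCount n y ≤ n!`. [folklore] -/
theorem permCount_le_factorial (n : ℕ) (y : Fin n × Fin n → Bool) : permCount n y ≤ n.factorial := by
  classical
  unfold permCount
  refine (Finset.card_filter_le _ _).trans ?_
  rw [Finset.card_univ, Fintype.card_perm, Fintype.card_fin]

/-- `n! < 2^{n·n+1}` (`n! ≤ nⁿ ≤ (2ⁿ)ⁿ`). [folklore] -/
theorem factorial_lt_two_pow_mul_succ (n : ℕ) : n.factorial < 2 ^ (n * n + 1) := by
  have h1 : n.factorial ≤ n ^ n := Nat.factorial_le_pow n
  have h2 : n ^ n ≤ (2 ^ n) ^ n := Nat.pow_le_pow_left Nat.lt_two_pow_self.le n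
  rw [← pow_mul] at h2
  have h3 : 2 ^ (n * n) < 2 ^ (n * n + 1) := Nat.pow_lt_pow_right (by norm_num) (by omega)
  omega

/-! ### The row-major `0/1` permanent function on bit strings -/

/-- The `0/1` array of an `n × n` matrix written row-major in a word: entry `(i, j)` is the letter
at position `i·n + j` (`false` past the end). [folklore] -/
def wordBits (w : List Bool) (n : ℕ) : Fin n × Fin n → Bool :=
  fun ij => w.getD (ij.1.val * n + ij.2.val) false

/-- The integer `0/1` matrix of a `0/1` array. [folklore] -/
def bitMatrix (n : ℕ) (y : Fin n × Fin n → Bool) : Matrix (Fin n) (Fin n) ℤ :=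
  Matrix.of fun i j => if y (i, j) then 1 else 0

/-- **The `0/1` permanent on bit strings, row-major convention**: a word of square length `n²` is
the `n × n` `0/1` matrix of its letters in row-major order and is sent to its permanent (a natural
number); words of non-square length are sent to `0`. (Valiant 1979, Thm. 1: the function
"permanent of a (0,1)-matrix".) [cite: Valiant1979, Thm. 1] -/
def per01PlainFn (w : List Bool) : ℕ :=
  if Nat.sqrt w.length * Nat.sqrt w.length = w.length then
    ((bitMatrix (Nat.sqrt w.length) (wordBits w (Nat.sqrt w.length))).permanent).toNat
  else 0

/-- On a word of square length the value is the permutation count of its array. [cite: Valiant1979, §1] -/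
theorem per01PlainFn_of_sq {w : List Bool} {n : ℕ} (h : w.length = n * n) :
    per01PlainFn w = permCount n (wordBits w n) := by
  have hs : Nat.sqrt w.length = n := by rw [h, Nat.sqrt_eq]
  rw [per01PlainFn, hs, if_pos h.symm, bitMatrix, permanent_of_bool, Int.toNat_natCast]

/-- On a word of non-square length the value is `0`. [folklore] -/
theorem per01PlainFn_of_not_sq {w : List Bool} (h : Nat.sqrt w.length * Nat.sqrt w.length ≠ w.length) :
    per01PlainFn w = 0 := by
  rw [per01PlainFn, if_neg h]

/-- **Bit length**: `per01PlainFn w < 2^{|w| + 1}` (`≤ n! < 2^{n²+1}`). [folklore] -/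
theorem per01PlainFn_lt_two_pow (w : List Bool) : per01PlainFn w < 2 ^ (w.length + 1) := by
  by_cases h : Nat.sqrt w.length * Nat.sqrt w.length = w.length
  · rw [per01PlainFn_of_sq h.symm]
    refine (permCount_le_factorial _ _).trans_lt ?_
    have := factorial_lt_two_pow_mul_succ (Nat.sqrt w.length)
    rwa [h] at this
  · rw [per01PlainFn_of_not_sq h]
    exact Nat.two_pow_pos _

/-- **Valiant's theorem (named fact): the `0/1` permanent is `#P`-hard** under polynomial-time
Turing reductions — every `#P` function is computable in polynomial time with oracle access to the
row-major `0/1` permanent function `per01PlainFn` (answers in binary; `IsSharpPHardFun`,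
`Counting.lean`). Valiant, TCS 8 (1979), Thm. 1: "the problem of computing the permanent of a
(0,1)-matrix is #P-complete" (the reduction `#SAT →` integer permanent `→` permanent mod small
primes `→ (0,1)`-permanent is a polynomial-time oracle computation, §3–§4). The same printed theorem
is recorded for square integer matrices in the structured code `encodingIntMatrix` as
`Literature.Computability.QuantumComplexity.permanent01_isSharpPHardFun`; here the input
convention is the plain one (an `n × n` `0/1` matrix is the word of its `n²` entries), which the
Boolean circuits of this file read directly. Not proved in the tree (Valiant's/Ben-Dor–Halevi's
gadget reduction with its oracle machine is a formalisation of its own). [cite: Valiant1979, Thm. 1] -/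
def Valiant1979_per01Plain_isSharpPHardFun : Prop :=
  IsSharpPHardFun per01PlainFn

/-! ### Boolean circuits for all bits of the `0/1` permanent from an arithmetic circuit for `PER_n` -/

section Circuits

variable {n ℓ : ℕ}

/-- Feeding a `0/1` input bit as a residue: bit `0` is the input, the other bits are `0`; one
(constant) gate. [folklore] -/
theorem cktSize_inputResidue (hℓ : 1 ≤ ℓ) (v : Fin n × Fin n) :
    CktSize B2 (fun (y : Fin n × Fin n → Bool) =>
      testBits ℓ (if y v then (1 : ZMod (2 ^ ℓ)) else 0).val) 1 := by
  haveI : Fact (1 < 2 ^ ℓ) := ⟨Nat.one_lt_two_pow (by omega)⟩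
  have h := ((CktSize.proj B2 fun _ : Unit => v).pair (cktSize_const (Fin n × Fin n) false)).outMap
    (fun i : Fin ℓ => if i.val = 0 then Sum.inl () else Sum.inr ())
  refine (h.congr fun y i => ?_).of_le (by norm_num)
  by_cases hi : i.val = 0
  · simp only [hi, if_true, Sum.elim_inl, testBits_apply]
    cases y v
    · simp
    · simp [ZMod.val_one]
  · simp only [hi, if_false, Sum.elim_inr, testBits_apply]
    cases y v
    · simp
    · rw [if_pos rfl, ZMod.val_one, ← Nat.pow_zero 2, Nat.testBit_two_pow_of_ne (Ne.symm hi)]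

/-- The generic permanent evaluated at a `0/1` point of `ZMod p` is the permutation count. [cite: Valiant1979, §1] -/
theorem aeval_perPoly_bool (p : ℕ) (y : Fin n × Fin n → Bool) :
    aeval (fun v => if y v then (1 : ZMod p) else 0) (perPoly (Fin n) ℤ) = (permCount n y : ZMod p) := by
  rw [MvPolynomial.aeval_def, ← MvPolynomial.eval_map, map_perPoly, eval_perPoly]
  exact permanent_of_bool (ZMod p) n y

/-- **All bits of the `0/1` permanent by Boolean circuits**: if the fan-in-two integer circuit `P`
computes `PER_n` and `n! < 2^ℓ`, `ℓ ≥ 1`, then the `ℓ` bits of `permCount n` (the whole number) are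
computed by `B₂`-circuits of size `(|P| + 1) · gateCost ℓ 1` — `P` simulated modulo `2^ℓ`
(Bürgisser, proof of Lemma 2.12: "evaluate the circuit for `PER_n` modulo `p_n > n!`"). [cite: Burgisser2006, Lemma 2.12] -/
theorem cktSize_permCount (hℓ : 1 ≤ ℓ) (hfact : n.factorial < 2 ^ ℓ) (P : ArithCircuit ℤ (Fin n × Fin n))
    (h2 : P.IsFanInTwo) (hP : P.Computes (perPoly (Fin n) ℤ)) :
    CktSize B2 (fun (y : Fin n × Fin n → Bool) => testBits ℓ (permCount n y)) ((P.size + 1) * gateCost ℓ 1) := by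
  haveI : NeZero (2 ^ ℓ) := ⟨pow_ne_zero _ two_ne_zero⟩
  have h := cktSize_testBits_aeval_eval (p := 2 ^ ℓ) le_rfl
    (fun (y : Fin n × Fin n → Bool) (v : Fin n × Fin n) => if y v then (1 : ZMod (2 ^ ℓ)) else 0)
    (fun v => cktSize_inputResidue hℓ v) P h2
  refine h.congr fun y i => ?_
  have hP' : P.eval = perPoly (Fin n) ℤ := hP
  rw [hP', aeval_perPoly_bool, ZMod.val_natCast_of_lt ((permCount_le_factorial n y).trans_lt hfact)]

end Circuits

/-! ### Polynomial-size bit circuits for `per01PlainFn` under `τ(PER_n) = n^{O(1)}` -/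

/-- Row-major position of an entry. [folklore] -/
def rowMajor (n : ℕ) (ij : Fin n × Fin n) : Fin (n * n) :=
  ⟨ij.1.val * n + ij.2.val, by
    have h1 := ij.1.isLt
    have h2 := ij.2.isLt
    calc ij.1.val * n + ij.2.val < ij.1.val * n + n := by omega
      _ = (ij.1.val + 1) * n := by ring
      _ ≤ n * n := Nat.mul_le_mul_right _ (by omega)⟩

/-- The size polynomial of the bit circuits, from the exponent `c` of `τ(PER_n) ≤ n^c + c`. [folklore] -/
def perBitsSizePoly (c : ℕ) : Polynomial ℕ :=
  (Polynomial.X ^ c + (c : Polynomial ℕ) + 1) * (2 + 65 * (Polynomial.X + 3) ^ 3) + 1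

/-- **Polynomial-size circuits for the bits of `per01PlainFn`** from `τ(PER_n) ≤ n^c + c`: at a
square length `m = n²` the circuit of `cktSize_permCount` (with `ℓ = m + 1`, rewired to the word),
elsewhere the constant `0`. [cite: Burgisser2006, Lemma 2.12] -/
theorem cktSize_per01PlainFn_bits {c : ℕ} (hc : ∀ n, constantFreeComplexity (perPoly (Fin n) ℤ) ≤ n ^ c + c)
    (m : ℕ) :
    CktSize B2 (fun (x : Fin m → Bool) (i : Fin (m + 1)) => (per01PlainFn (List.ofFn x)).testBit i)
      ((perBitsSizePoly c).eval m) := by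
  by_cases hsq : Nat.sqrt m * Nat.sqrt m = m
  · -- square length `m = n * n`
    set n := Nat.sqrt m with hn
    obtain ⟨P, h2, -, hP, hsize⟩ := exists_computes_size_eq_constantFreeComplexity (perPoly (Fin n) ℤ)
    have hfact : n.factorial < 2 ^ (m + 1) := by
      have := factorial_lt_two_pow_mul_succ n; rwa [hsq] at this
    have h := (cktSize_permCount (by omega) hfact P h2 hP).rewire (ι' := Fin m)
      (fun ij => Fin.cast hsq (rowMajor n ij))
    refine (h.congr fun x i => ?_).of_le ?_
    · simp only [testBits_apply]
      rw [per01PlainFn_of_sq (by rw [List.length_ofFn, hsq])]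
      congr 2
      funext ij
      rw [wordBits, List.getD_eq_getElem?_getD, List.getElem?_ofFn]
      have hlt : ij.1.val * n + ij.2.val < m := by rw [← hsq]; exact (rowMajor n ij).isLt
      simp [hlt, Fin.cast, rowMajor]
    · have hnm : n ≤ m := by
        rw [← hsq]
        rcases Nat.eq_zero_or_pos n with h0 | hpos
        · simp [h0]
        · exact Nat.le_mul_of_pos_left n hpos
      have hs : P.size ≤ m ^ c + c := by
        rw [hsize]; exact (hc n).trans (by gcongr)
      have hg := gateCost_le (m + 1) 1
      simp only [perBitsSizePoly, Polynomial.eval_add, Polynomial.eval_mul, Polynomial.eval_pow,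
        Polynomial.eval_X, Polynomial.eval_natCast, Polynomial.eval_ofNat, Polynomial.eval_one]
      calc (P.size + 1) * gateCost (m + 1) 1 ≤ (m ^ c + c + 1) * (2 + 65 * (m + 3) ^ 3) :=
            Nat.mul_le_mul (by omega) (by simpa [add_assoc] using hg)
        _ ≤ (m ^ c + c + 1) * (2 + 65 * (m + 3) ^ 3) + 1 := Nat.le_succ _
  · -- non-square length: the function is `0`
    have h0 : ∀ x : Fin m → Bool, per01PlainFn (List.ofFn x) = 0 := fun x =>
      per01PlainFn_of_not_sq (by rwa [List.length_ofFn])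
    have h := (cktSize_const (Fin m) false).outMap (fun _ : Fin (m + 1) => ())
    refine (h.congr fun x i => ?_).of_le ?_
    · rw [h0 x, Nat.zero_testBit]
    · simp only [perBitsSizePoly, Polynomial.eval_add, Polynomial.eval_one]
      omega

/-- **`per01PlainFn ∈ FP/poly` under `τ(PER_n) = n^{O(1)}`**: the bit circuits packaged. [cite: Burgisser2006, Lemma 2.12] -/
theorem nonempty_bitCircuits_per01PlainFn
    (hτ : IsPBounded fun n => constantFreeComplexity (perPoly (Fin n) ℤ)) :
    Nonempty (BitCircuits per01PlainFn) := by
  obtain ⟨c, hc⟩ := hτ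
  exact ⟨{ K := Polynomial.X + 1
           s := perBitsSizePoly c
           lt := fun x => by simpa using per01PlainFn_lt_two_pow x
           ckt := fun m => by
             rw [show (Polynomial.X + 1 : Polynomial ℕ).eval m = m + 1 by simp]
             exact cktSize_per01PlainFn_bits hc m }⟩

/-- Hence **`P^{per01PlainFn} ⊆ P/poly`** under `τ(PER_n) = n^{O(1)}` (the bit graph is in `P/poly`
and `P/poly` is closed under polynomial-time Turing reductions, `BitGraphPPoly.lean`). [cite: Burgisser2006, Lemma 2.12] -/
theorem PRel_per01PlainFn_subset_PPoly
    (hτ : IsPBounded fun n => constantFreeComplexity (perPoly (Fin n) ℤ)) :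
    PRel (Oracle.ofFun per01PlainFn) ⊆ PPoly := by
  obtain ⟨B⟩ := nonempty_bitCircuits_per01PlainFn hτ
  exact B.PRel_ofFun_subset_PPoly_of_bitCircuits

/-! ### Bürgisser's Lemma 2.12 from Valiant's theorem -/

/-- **Bürgisser's Lemma 2.12 (ECCC TR06-113; STACS 2007 Lemma 11) from Valiant's theorem**:
if the `0/1` permanent is `#P`-hard then `τ(PER_n) = n^{O(1)}` implies `PP ⊆ P/poly` — the
discharge of the tree's named fact `PP_subset_PPoly_of_isPBounded_perPoly` modulo
`Valiant1979_per01Plain_isSharpPHardFun`: `PP ⊆ P^{#P} ⊆ P^{PER} ⊆ P/poly`. [cite: Burgisser2006, Lemma 2.12] -/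
theorem PP_subset_PPoly_of_isPBounded_perPoly_of_valiant (hV : Valiant1979_per01Plain_isSharpPHardFun) :
    PP_subset_PPoly_of_isPBounded_perPoly := fun hτ L hL => by
  -- `PP ⊆ P^{#P}`; a `#P`-hard function oracle decides `P^{#P}` (every `f ∈ #P` is in `FP^{per}`,
  -- and `f ∈ FP^O ⟹ P^f ⊆ P^O`; cf. `QuantumComplexity.PSharpP_subset_PRel_ofFun_of_isSharpPHardFun`,
  -- not imported to keep the permanent files free of the boson-sampling chain); then `P^{per} ⊆ P/poly`.
  obtain ⟨f, hf, hLf⟩ := Set.mem_iUnion₂.1 (PP_subset_PSharpP_holds hL)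
  exact PRel_per01PlainFn_subset_PPoly hτ (OracleAlg.PRel_subset_PRel_of_mem_FPRel (hV f hf) hLf)

end Literature.Computability.AlgebraicComplexity
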